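import Mathlib
import Summits.Ventures.PercRepro2.Defs
import Summits.Ventures.PercRepro2.Independence
import Summits.Ventures.PercRepro2.Harris
import Summits.Ventures.PercRepro2.Graph
import Summits.Ventures.PercRepro2.Events
import Summits.Ventures.PercRepro2.ZCClusterBlind
import Summits.Ventures.PercRepro2.ZCRootDecomp
import Summits.Ventures.PercRepro2.ZCCondProb

/-!
# (ZC) follows from the between inequality `(Θ-PA)` of the partition of `G − a₁` (blind cell PercRepro2, mine-a g28)

Write `F` for the edges not at `a₁`.  For an event `A` let `condProb A ω` be the probability of `A`
given the configuration of `F` (the edges of `a₁` re-randomised).  The **fibrewise product rule**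
(`expect_indicator_mul_eq_condProb_mul`): if, for every configuration of `F`, `A` and `B` are determined
by disjoint sets of edges at `a₁`, then `E[1_A 1_B] = E[condProb A · 1_B]`.

For the cluster-blind event `Ũ = {C(a₁) ∪ C'(a₃) ∪ C'(o) ∈ 𝓔}` (`clusterBlindEvent`) and the events
`e ∩ L`, `e ∩ Lᶜ` this applies: by the root decomposition `C(a₁) = {a₁} ∪ ⋃ C'(v)` over the open
neighbours `v`, the event `Ũ` looks only at the edges of `a₁` into vertices outside `C'(a₃) ∪ C'(o)`,
while `e = {a₃ ∈ C(a₁)}` and `L = {o ∈ C(a₁)}` look only at the edges of `a₁` into `C'(a₃) ∪ C'(o)`.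
Hence the (ZC) expression of `Ũ` equals the (ZC) expression of the function `û = condProb Ũ`, which is
monotone and depends only on the connectivity relation of `G − a₁`.

**`(Θ-PA)`** (`ThetaPA`): the (ZC) expression is nonnegative for every monotone function of the
connectivity relation of `G − a₁`.  **Theorem** (`zc_of_thetaPA`): `(Θ-PA)` implies (ZC) for every
cluster up-set, via the cluster-blind reduction `zc_of_cluster_blind`.  (MINE-A.md §78.)
-/

namespace Summit.Ventures.PercRepro2

variable {V : Type*} {E : Type*} [Fintype V] [DecidableEq V] [Fintype E] [DecidableEq E]
  {R : Type*} [CommRing R] [LinearOrder R] [IsStrictOrderedRing R]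

/-! ## The fibres of the cluster-blind event and of `e`, `L` over the configuration of `G − a₁` -/

section Main

variable (ends : E → Sym2 V) (a₁ a₃ o : V)

/-- The configuration of `G − a₁` with first component `σ₁` (every edge at `a₁` closed). -/
abbrev baseConfig (σ₁ : {e // e ∈ awayEdges ends a₁} → Bool) : Config E :=
  glue (awayEdges ends a₁) σ₁ (fun _ => false)

/-- The edges of `a₁` into `C'(a₃) ∪ C'(o)` (the blocks of the two marks in `G − a₁`). -/
def intoMarks (σ₁ : {e // e ∈ awayEdges ends a₁} → Bool) : Set {e // e ∉ awayEdges ends a₁} :=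
  {e | ∃ v ∈ cluster ends (baseConfig ends a₁ σ₁) a₃ ∪ cluster ends (baseConfig ends a₁ σ₁) o,
    ends e = s(a₁, v)}

omit [Fintype E] [DecidableEq E] in
/-- The root cluster of a glued configuration, decomposed over the open neighbours. -/
lemma cluster_glue_root (σ₁ : {e // e ∈ awayEdges ends a₁} → Bool)
    (σ₂ : {e // e ∉ awayEdges ends a₁} → Bool) :
    cluster ends (glue (awayEdges ends a₁) σ₁ σ₂) a₁ =
      insert a₁ (⋃ v ∈ openNbr ends (glue (awayEdges ends a₁) σ₁ σ₂) a₁,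
        cluster ends (baseConfig ends a₁ σ₁) v) := by
  rw [cluster_root_decomp, deleteVertex_glue]

omit [Fintype V] [DecidableEq V] [Fintype E] [DecidableEq E] in
/-- `v ∈ C'(x)` iff `x ∈ C'(v)`. -/
lemma mem_cluster_comm {ω : Config E} {x v : V} :
    v ∈ cluster ends ω x ↔ x ∈ cluster ends ω v :=
  ⟨fun h => conn_symm h, fun h => conn_symm h⟩

omit [Fintype E] [DecidableEq E] in
/-- A mark `x ≠ a₁` lies in the root cluster iff some open edge of `a₁` enters `C'(x)`. -/
lemma mark_mem_cluster_glue_iff (σ₁ : {e // e ∈ awayEdges ends a₁} → Bool)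
    (σ₂ : {e // e ∉ awayEdges ends a₁} → Bool) {x : V} (hx : x ≠ a₁) :
    x ∈ cluster ends (glue (awayEdges ends a₁) σ₁ σ₂) a₁ ↔
      ∃ e : {e // e ∉ awayEdges ends a₁}, σ₂ e = true ∧
        ∃ v ∈ cluster ends (baseConfig ends a₁ σ₁) x, ends e = s(a₁, v) := by
  rw [cluster_glue_root, Set.mem_insert_iff, Set.mem_iUnion₂]
  constructor
  · rintro (h | ⟨v, hv, hxv⟩)
    · exact absurd h hx
    · obtain ⟨e, he, hends⟩ := (mem_openNbr_glue_iff ends a₁ σ₁ σ₂ v).1 hv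
      exact ⟨e, he, v, (mem_cluster_comm ends).1 hxv, hends⟩
  · rintro ⟨e, he, v, hv, hends⟩
    exact Or.inr ⟨v, (mem_openNbr_glue_iff ends a₁ σ₁ σ₂ v).2 ⟨e, he, hends⟩,
      (mem_cluster_comm ends).2 hv⟩

omit [Fintype E] [DecidableEq E] in
/-- Over a fixed configuration of `G − a₁`, the event `{x ∈ C(a₁)}` (`x ∈ {a₃, o}`) is determined
by the edges of `a₁` into `C'(a₃) ∪ C'(o)`. -/
lemma dependsOn_mark_fibre (σ₁ : {e // e ∈ awayEdges ends a₁} → Bool) {x : V} (hx : x ≠ a₁)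
    (hsub : cluster ends (baseConfig ends a₁ σ₁) x ⊆
      cluster ends (baseConfig ends a₁ σ₁) a₃ ∪ cluster ends (baseConfig ends a₁ σ₁) o) :
    DependsOn (fun σ₂ => glue (awayEdges ends a₁) σ₁ σ₂ ∈ connEvent ends a₁ x)
      (intoMarks ends a₁ a₃ o σ₁) := by
  intro σ₂ σ₂' h
  apply propext
  simp only [mem_connEvent]
  change x ∈ cluster ends (glue (awayEdges ends a₁) σ₁ σ₂) a₁ ↔
    x ∈ cluster ends (glue (awayEdges ends a₁) σ₁ σ₂') a₁
  rw [mark_mem_cluster_glue_iff ends a₁ σ₁ σ₂ hx, mark_mem_cluster_glue_iff ends a₁ σ₁ σ₂' hx]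
  constructor
  · rintro ⟨e, he, v, hv, hends⟩
    refine ⟨e, ?_, v, hv, hends⟩
    rw [← h e ⟨v, hsub hv, hends⟩]; exact he
  · rintro ⟨e, he, v, hv, hends⟩
    refine ⟨e, ?_, v, hv, hends⟩
    rw [h e ⟨v, hsub hv, hends⟩]; exact he

omit [Fintype E] [DecidableEq E] in
/-- The open neighbours outside `C'(a₃) ∪ C'(o)` are read off the edges NOT into the marks. -/
lemma openNbr_diff_eq (σ₁ : {e // e ∈ awayEdges ends a₁} → Bool)
    {σ₂ σ₂' : {e // e ∉ awayEdges ends a₁} → Bool}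
    (h : ∀ e ∈ (intoMarks ends a₁ a₃ o σ₁)ᶜ, σ₂ e = σ₂' e) :
    openNbr ends (glue (awayEdges ends a₁) σ₁ σ₂) a₁ \
        (cluster ends (baseConfig ends a₁ σ₁) a₃ ∪ cluster ends (baseConfig ends a₁ σ₁) o) =
      openNbr ends (glue (awayEdges ends a₁) σ₁ σ₂') a₁ \
        (cluster ends (baseConfig ends a₁ σ₁) a₃ ∪ cluster ends (baseConfig ends a₁ σ₁) o) := by
  ext v
  simp only [Set.mem_sdiff, mem_openNbr_glue_iff]
  -- an edge `a₁–v` with `v` outside the marks' blocks is not an edge into the marks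
  have key : ∀ e : {e // e ∉ awayEdges ends a₁}, ends e = s(a₁, v) →
      v ∉ cluster ends (baseConfig ends a₁ σ₁) a₃ ∪ cluster ends (baseConfig ends a₁ σ₁) o →
      e ∈ (intoMarks ends a₁ a₃ o σ₁)ᶜ := by
    intro e hends hv hmem
    obtain ⟨w, hw, hends'⟩ := hmem
    rw [hends] at hends'
    rcases Sym2.eq_iff.1 hends' with ⟨_, hvw⟩ | ⟨hav, hwa⟩
    · exact hv (hvw ▸ hw)
    · exact hv (by rw [hwa.trans hav]; exact hw)

  constructor
  · rintro ⟨⟨e, he, hends⟩, hv⟩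
    exact ⟨⟨e, by rw [← h e (key e hends hv)]; exact he, hends⟩, hv⟩
  · rintro ⟨⟨e, he, hends⟩, hv⟩
    exact ⟨⟨e, by rw [h e (key e hends hv)]; exact he, hends⟩, hv⟩

omit [Fintype E] [DecidableEq E] in
/-- The cluster-blind set `C(a₁) ∪ C'(a₃) ∪ C'(o)` only uses the open neighbours outside the two
blocks. -/
lemma clusterBlind_set_eq (σ₁ : {e // e ∈ awayEdges ends a₁} → Bool)
    (σ₂ : {e // e ∉ awayEdges ends a₁} → Bool) :
    cluster ends (glue (awayEdges ends a₁) σ₁ σ₂) a₁ ∪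
        cluster ends (baseConfig ends a₁ σ₁) a₃ ∪ cluster ends (baseConfig ends a₁ σ₁) o =
      insert a₁ ((⋃ v ∈ openNbr ends (glue (awayEdges ends a₁) σ₁ σ₂) a₁ \
          (cluster ends (baseConfig ends a₁ σ₁) a₃ ∪ cluster ends (baseConfig ends a₁ σ₁) o),
            cluster ends (baseConfig ends a₁ σ₁) v) ∪
        (cluster ends (baseConfig ends a₁ σ₁) a₃ ∪ cluster ends (baseConfig ends a₁ σ₁) o)) := by
  rw [cluster_glue_root]
  ext u
  simp only [Set.mem_union, Set.mem_insert_iff, Set.mem_iUnion₂, Set.mem_sdiff]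
  constructor
  · rintro (((h | ⟨v, hv, huv⟩) | hA) | hO)
    · exact Or.inl h
    · by_cases hvm : v ∈ cluster ends (baseConfig ends a₁ σ₁) a₃ ∪
          cluster ends (baseConfig ends a₁ σ₁) o
      · -- `v` in a mark's block: `C'(v)` is that block
        rcases hvm with hvA | hvO
        · exact Or.inr (Or.inr (Or.inl (by rw [cluster_eq_of_conn hvA]; exact huv)))
        · exact Or.inr (Or.inr (Or.inr (by rw [cluster_eq_of_conn hvO]; exact huv)))
      · exact Or.inr (Or.inl ⟨v, ⟨hv, hvm⟩, huv⟩)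
    · exact Or.inr (Or.inr (Or.inl hA))
    · exact Or.inr (Or.inr (Or.inr hO))
  · rintro (h | ⟨v, ⟨hv, _⟩, huv⟩ | hA | hO)
    · exact Or.inl (Or.inl (Or.inl h))
    · exact Or.inl (Or.inl (Or.inr ⟨v, hv, huv⟩))
    · exact Or.inl (Or.inr hA)
    · exact Or.inr hO

omit [Fintype E] [DecidableEq E] in
/-- Over a fixed configuration of `G − a₁`, the cluster-blind event is determined by the edges of
`a₁` NOT into `C'(a₃) ∪ C'(o)`. -/
lemma dependsOn_clusterBlind_fibre (σ₁ : {e // e ∈ awayEdges ends a₁} → Bool)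
    (𝓔 : Set (Set V)) :
    DependsOn (fun σ₂ => glue (awayEdges ends a₁) σ₁ σ₂ ∈ clusterBlindEvent ends a₁ a₃ o 𝓔)
      (intoMarks ends a₁ a₃ o σ₁)ᶜ := by
  intro σ₂ σ₂' h
  apply propext
  simp only [mem_clusterBlindEvent, deleteVertex_glue]
  change cluster ends (glue (awayEdges ends a₁) σ₁ σ₂) a₁ ∪
      cluster ends (baseConfig ends a₁ σ₁) a₃ ∪ cluster ends (baseConfig ends a₁ σ₁) o ∈ 𝓔 ↔
    cluster ends (glue (awayEdges ends a₁) σ₁ σ₂') a₁ ∪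
      cluster ends (baseConfig ends a₁ σ₁) a₃ ∪ cluster ends (baseConfig ends a₁ σ₁) o ∈ 𝓔
  rw [clusterBlind_set_eq, clusterBlind_set_eq, openNbr_diff_eq ends a₁ a₃ o σ₁ h]

end Main

/-! ## `(Θ-PA)` and the theorem -/

section Theorem

variable (ends : E → Sym2 V) (p : E → R) (a₁ a₃ o : V)

/-- **`(Θ-PA)`**: the (ZC) expression `P(D)·Cov(f, eL) − P(B)·Cov(f, e¬L)` is nonnegative for every
monotone function `f` of the connectivity relation of `G − a₁` (MINE-A.md §78.1). -/
def ThetaPA : Prop :=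
  ∀ f : Config E → R, Monotone f →
    (∀ ω ω' : Config E, (∀ u v, Conn ends (deleteVertex ends a₁ ω) u v ↔
      Conn ends (deleteVertex ends a₁ ω') u v) → f ω = f ω') →
    let e := connEvent ends a₁ a₃
    let L' := connEvent ends a₁ o
    let γ := connEvent ends a₃ o
    0 ≤ prob p (eᶜ ∩ L'ᶜ ∩ γᶜ) *
          (expect p (fun ω => f ω * (e ∩ L').indicator 1 ω) - expect p f * prob p (e ∩ L'))
      - prob p (eᶜ ∩ L'ᶜ ∩ γ) *
          (expect p (fun ω => f ω * (e ∩ L'ᶜ).indicator 1 ω) - expect p f * prob p (e ∩ L'ᶜ))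

omit [Fintype V] [DecidableEq V] [Fintype E] [DecidableEq E] [LinearOrder R] [IsStrictOrderedRing R] in
/-- Gluing is monotone in the first component. -/
lemma glue_mono_left (F : Set E) [DecidablePred (· ∈ F)] {σ₁ σ₁' : {e // e ∈ F} → Bool}
    (h : σ₁ ≤ σ₁') (σ₂ : {e // e ∉ F} → Bool) : glue F σ₁ σ₂ ≤ glue F σ₁' σ₂ := by
  intro e
  by_cases he : e ∈ F
  · rw [glue_apply_of_mem _ _ _ he, glue_apply_of_mem _ _ _ he]; exact h ⟨e, he⟩
  · rw [glue_apply_of_notMem _ _ _ he, glue_apply_of_notMem _ _ _ he]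

omit [Fintype V] [DecidableEq V] in
/-- The conditional probability of an increasing event is a monotone function. -/
lemma condProb_monotone (F : Set E) [DecidablePred (· ∈ F)] (hp : IsProbVec p)
    {A : Set (Config E)} (hA : IsUpperSet A) : Monotone (condProb p F A) := by
  intro ω ω' h
  unfold condProb
  refine Finset.sum_le_sum fun σ₂ _ => ?_
  have hp₂ : IsProbVec (fun i : {e // e ∉ F} => p i) := ⟨fun i => hp.nonneg i, fun i => hp.le_one i⟩
  refine mul_le_mul_of_nonneg_left ?_ (weight_nonneg hp₂ σ₂)
  exact monotone_indicator_of_isUpperSet (R := R) hA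
    (glue_mono_left F (fun i => h i) σ₂)

omit [Fintype E] [DecidableEq E] in
/-- The base configuration of the restriction of `ω` is `G − a₁` under `ω`. -/
lemma baseConfig_restrictTo (ω : Config E) :
    baseConfig ends a₁ (restrictTo (awayEdges ends a₁) ω) = deleteVertex ends a₁ ω := by
  funext e
  unfold baseConfig
  rw [deleteVertex_eq_restrict]
  by_cases he : e ∈ awayEdges ends a₁
  · rw [glue_apply_of_mem _ _ _ he, restrict_apply_of_mem he]; rfl
  · rw [glue_apply_of_notMem _ _ _ he, restrict_apply_of_notMem he]

omit [Fintype E] [DecidableEq E] in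
/-- Membership in the cluster-blind event of a glued configuration, with the open neighbours made
explicit (they only depend on the second component). -/
lemma clusterBlind_glue_mem_iff (σ₁ : {e // e ∈ awayEdges ends a₁} → Bool)
    (σ₂ : {e // e ∉ awayEdges ends a₁} → Bool) (𝓔 : Set (Set V)) :
    glue (awayEdges ends a₁) σ₁ σ₂ ∈ clusterBlindEvent ends a₁ a₃ o 𝓔 ↔
      insert a₁ ((⋃ v ∈ {v : V | ∃ e : {e // e ∉ awayEdges ends a₁}, σ₂ e = true ∧ ends e = s(a₁, v)} \
          (cluster ends (baseConfig ends a₁ σ₁) a₃ ∪ cluster ends (baseConfig ends a₁ σ₁) o),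
            cluster ends (baseConfig ends a₁ σ₁) v) ∪
        (cluster ends (baseConfig ends a₁ σ₁) a₃ ∪ cluster ends (baseConfig ends a₁ σ₁) o)) ∈ 𝓔 := by
  rw [mem_clusterBlindEvent, deleteVertex_glue, clusterBlind_set_eq]
  have hN : openNbr ends (glue (awayEdges ends a₁) σ₁ σ₂) a₁ =
      {v : V | ∃ e : {e // e ∉ awayEdges ends a₁}, σ₂ e = true ∧ ends e = s(a₁, v)} := by
    ext v
    exact mem_openNbr_glue_iff ends a₁ σ₁ σ₂ v
  rw [hN]

omit [LinearOrder R] [IsStrictOrderedRing R] in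
/-- The conditional probability of the cluster-blind event depends only on the connectivity
relation of `G − a₁`. -/
lemma condProb_clusterBlind_congr (𝓔 : Set (Set V)) {ω ω' : Config E}
    (h : ∀ u v, Conn ends (deleteVertex ends a₁ ω) u v ↔ Conn ends (deleteVertex ends a₁ ω') u v) :
    condProb p (awayEdges ends a₁) (clusterBlindEvent ends a₁ a₃ o 𝓔) ω =
      condProb p (awayEdges ends a₁) (clusterBlindEvent ends a₁ a₃ o 𝓔) ω' := by
  have hcl : ∀ x, cluster ends (deleteVertex ends a₁ ω) x = cluster ends (deleteVertex ends a₁ ω') x := by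
    intro x
    ext u
    exact h x u
  unfold condProb
  refine Finset.sum_congr rfl fun σ₂ _ => ?_
  congr 1
  have key : glue (awayEdges ends a₁) (restrictTo (awayEdges ends a₁) ω) σ₂ ∈
      clusterBlindEvent ends a₁ a₃ o 𝓔 ↔
      glue (awayEdges ends a₁) (restrictTo (awayEdges ends a₁) ω') σ₂ ∈
      clusterBlindEvent ends a₁ a₃ o 𝓔 := by
    rw [clusterBlind_glue_mem_iff, clusterBlind_glue_mem_iff, baseConfig_restrictTo,
      baseConfig_restrictTo]
    simp only [hcl]
  by_cases hm : glue (awayEdges ends a₁) (restrictTo (awayEdges ends a₁) ω) σ₂ ∈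
      clusterBlindEvent ends a₁ a₃ o 𝓔
  · rw [Set.indicator_of_mem hm, Set.indicator_of_mem (key.1 hm)]
    rfl
  · rw [Set.indicator_of_notMem hm, Set.indicator_of_notMem (fun h' => hm (key.2 h'))]

omit [Fintype E] [DecidableEq E] in
/-- Over a fixed configuration of `G − a₁`, `e ∩ L` and `e ∩ Lᶜ` are determined by the edges of
`a₁` into the two blocks. -/
lemma dependsOn_eL_fibre (σ₁ : {e // e ∈ awayEdges ends a₁} → Bool) (h13 : a₃ ≠ a₁)
    (h1o : o ≠ a₁) :
    DependsOn (fun σ₂ => glue (awayEdges ends a₁) σ₁ σ₂ ∈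
        connEvent ends a₁ a₃ ∩ connEvent ends a₁ o) (intoMarks ends a₁ a₃ o σ₁) ∧
    DependsOn (fun σ₂ => glue (awayEdges ends a₁) σ₁ σ₂ ∈
        connEvent ends a₁ a₃ ∩ (connEvent ends a₁ o)ᶜ) (intoMarks ends a₁ a₃ o σ₁) := by
  have hA := dependsOn_mark_fibre ends a₁ a₃ o σ₁ h13 Set.subset_union_left
  have hO := dependsOn_mark_fibre ends a₁ a₃ o σ₁ h1o Set.subset_union_right
  constructor
  · intro σ₂ σ₂' h
    apply propext
    simp only [Set.mem_inter_iff]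
    exact and_congr (hA h).to_iff (hO h).to_iff
  · intro σ₂ σ₂' h
    apply propext
    simp only [Set.mem_inter_iff, Set.mem_compl_iff]
    exact and_congr (hA h).to_iff (not_congr (hO h).to_iff)

/-- **`(Θ-PA)` implies (ZC)** for every cluster up-set (MINE-A.md §78.2): the (ZC) expression of a
cluster up-set dominates that of its cluster-blind event (`zc_cluster_blind_le`), which equals the
(ZC) expression of the monotone partition function `û = condProb Ũ` by the fibrewise product rule. -/
theorem zc_of_thetaPA (hp : IsProbVec p) (h13 : a₃ ≠ a₁) (h1o : o ≠ a₁)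
    (hΘ : ThetaPA ends p a₁ a₃ o) {𝓔 : Set (Set V)} (h𝓔 : IsUpperSet 𝓔) :
    let e := connEvent ends a₁ a₃
    let L' := connEvent ends a₁ o
    let γ := connEvent ends a₃ o
    let U := clusterInEvent ends a₁ 𝓔
    0 ≤ prob p (eᶜ ∩ L'ᶜ ∩ γᶜ) * (prob p (U ∩ (e ∩ L')) - prob p U * prob p (e ∩ L'))
      - prob p (eᶜ ∩ L'ᶜ ∩ γ) * (prob p (U ∩ (e ∩ L'ᶜ)) - prob p U * prob p (e ∩ L'ᶜ)) := by
  refine zc_of_cluster_blind hp a₁ a₃ o ?_ h𝓔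
  intro 𝓔' h𝓔' e L' γ U'
  set F := awayEdges ends a₁ with hF
  set û := condProb p F U' with hû
  -- the fibrewise product rule for `U'` against `B ∈ {e ∩ L', e ∩ L'ᶜ, univ}`
  have hprod : ∀ B : Set (Config E),
      (∀ σ₁, DependsOn (fun σ₂ => glue F σ₁ σ₂ ∈ B) (intoMarks ends a₁ a₃ o σ₁)) →
      prob p (U' ∩ B) = expect p (fun ω => û ω * B.indicator 1 ω) := by
    intro B hB
    rw [prob_eq_expect_indicator]
    have h1 : expect p ((U' ∩ B).indicator 1) =
        expect p (fun ω => U'.indicator 1 ω * B.indicator 1 ω) := by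
      unfold expect
      exact Finset.sum_congr rfl fun ω _ => by rw [indicator_inter_one]
    rw [h1]
    exact expect_indicator_mul_eq_condProb_mul p F U' B fun σ₁ =>
      ⟨(intoMarks ends a₁ a₃ o σ₁)ᶜ, intoMarks ends a₁ a₃ o σ₁, disjoint_compl_left,
        dependsOn_clusterBlind_fibre ends a₁ a₃ o σ₁ 𝓔', hB σ₁⟩
  have hU : prob p U' = expect p û := by
    have := hprod Set.univ (fun σ₁ => by intro σ₂ σ₂' _; rfl)
    rw [Set.inter_univ] at this
    rw [this]
    unfold expect
    exact Finset.sum_congr rfl fun ω _ => by simp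
  have heL : prob p (U' ∩ (e ∩ L')) = expect p (fun ω => û ω * (e ∩ L').indicator 1 ω) :=
    hprod _ fun σ₁ => (dependsOn_eL_fibre ends a₁ a₃ o σ₁ h13 h1o).1
  have henL : prob p (U' ∩ (e ∩ L'ᶜ)) = expect p (fun ω => û ω * (e ∩ L'ᶜ).indicator 1 ω) :=
    hprod _ fun σ₁ => (dependsOn_eL_fibre ends a₁ a₃ o σ₁ h13 h1o).2
  have hmono : Monotone û := condProb_monotone p F hp (isUpperSet_clusterBlindEvent ends a₁ a₃ o h𝓔')
  have hmeas : ∀ ω ω' : Config E, (∀ u v, Conn ends (deleteVertex ends a₁ ω) u v ↔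
      Conn ends (deleteVertex ends a₁ ω') u v) → û ω = û ω' :=
    fun ω ω' h => condProb_clusterBlind_congr ends p a₁ a₃ o 𝓔' h
  have h := hΘ û hmono hmeas
  simp only at h
  rw [hU, heL, henL]
  exact h

end Theorem

end Summit.Ventures.PercRepro2
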